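import Summits.AtomisticToContinuum.HydrodynamicLimit.Theorems.EquilibriumFastWindowLD.Negative.WithoutOrthEnergy

/-!
# `EquilibriumFastWindowLD` — negative knowledge (a.1): orthogonality to the CONSTANTS is load-bearing

Support file for crux `stmt-AtomisticToContinuum-14440` (`TwoClocks.EquilibriumFastWindowLD`), written by
the standing disprover (cdisprove seat). `EquilibriumFastWindowLDWithoutOrthOne` is the crux with the single
clause `∀ x, ∫ F(x,v) M_{1,u₀,θ₀}(v) dv = 0` DELETED (all other tokens verbatim) and it is FALSE,
unconditionally. The point is that the two REMAINING clauses do not let one simply add a constant to an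
admissible `F` (`1` is not `⊥ |v|²`): the witness is `F(x,v) = 5 − ‖v‖²`, which IS orthogonal to `v_j`
(parity) and to `|v|²` (`5·3 − 15 = 0`, the Wick value `E‖v‖⁴ = 15`) but has Maxwellian mean `2`. Its window
sum `5(N+1) − 2E(z)` is conserved, so at every window the moment is `(e^{5β}(1+2β)^{-3/2})^{N+1} = e^{2ε(N+1)}`
with `ε := ½(5β − (3/2)log(1+2β)) > 0` (`log(1+2β) < 2β`): the conclusion fails at `β = min β₀ ¼`, this
`ε`, every `τ`, at `N = N₀` (`a₀ = θ₀ = 1`, `u₀ = 0`, Alexander flows, any small `σ`).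
-/

noncomputable section

open MeasureTheory ProbabilityTheory Real Set
open scoped ENNReal

namespace Summit.AtomisticToContinuum.HydrodynamicLimit.Theorems.EquilibriumFastWindowLDNegative

open Literature.Analysis.FluidPDE Literature.MathematicalPhysics.KineticTheory
open Summit.AtomisticToContinuum.HydrodynamicLimit.Theorems.CorrectorPressureDecayNegative

/-- `TwoClocks.EquilibriumFastWindowLD` with the clause `F ⊥ 1` (`∀ x, ∫ F(x,v) M = 0`) DELETED; all
other tokens verbatim. A variant statement refuted below, not a fact. -/
def EquilibriumFastWindowLDWithoutOrthOne : Prop :=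
  ∃ σ₀ : ℝ, 0 < σ₀ ∧ ∀ (a₀ θ₀ : ℝ) (u₀ : V3), 0 < a₀ → 0 < θ₀ → ∀ σ : ℝ, 0 < σ → σ < σ₀ →
    ∀ Φ : (N : ℕ) → HardSphereFlow (Torus.geometry (Fin 3)) (hsDiameter σ N) (N + 1),
    ∀ F : T3 × V3 → ℝ, Continuous F → (∃ C : ℝ, ∀ y, |F y| ≤ C * (1 + ‖y.2‖ ^ 2)) →
    (∀ x (j : Fin 3), ∫ v, F (x, v) * v j * localMaxwellian 1 θ₀ u₀ v = 0) →
    (∀ x, ∫ v, F (x, v) * ‖v‖ ^ 2 * localMaxwellian 1 θ₀ u₀ v = 0) →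
    ∃ β₀ : ℝ, 0 < β₀ ∧ ∀ β : ℝ, |β| ≤ β₀ → ∀ ε : ℝ, 0 < ε → ∃ τ : ℝ, 0 < τ ∧ ∃ N₀ : ℕ,
      ∀ N : ℕ, N₀ ≤ N →
        ∫⁻ z, ENNReal.ofReal (Real.exp (β * ∑ i : Fin (N + 1),
            (τ * ((N : ℝ) + 1) ^ (-(1 / 3 : ℝ)))⁻¹ *
              ∫ r in (0 : ℝ)..(τ * ((N : ℝ) + 1) ^ (-(1 / 3 : ℝ))), F (((Φ N).flow r z) i)))
          ∂(localGibbsLaw σ (fun _ => a₀) (fun _ => u₀) (fun _ => θ₀) N (Φ N)) ≤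
        ENNReal.ofReal (Real.exp (ε * ((N : ℝ) + 1)))

/-- **(a.1) Orthogonality to the constants is load-bearing.** [folklore] -/
theorem equilibriumFastWindowLD_false_without_orthOne : ¬ EquilibriumFastWindowLDWithoutOrthOne := by
  rintro ⟨σ₀, hσ₀, h⟩
  set σ : ℝ := min (σ₀ / 2) (1 / 4) with hσdef
  have hσpos : 0 < σ := lt_min (by linarith) (by norm_num)
  have hσlt : σ < σ₀ := (min_le_left _ _).trans_lt (by linarith)
  have hσ2 : σ ≤ 1 / 2 := (min_le_right _ _).trans (by norm_num)
  have hσhalf : σ < 2⁻¹ := (min_le_right _ _).trans_lt (by norm_num)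
  set Φ : (N : ℕ) → HardSphereFlow (Torus.geometry (Fin 3)) (hsDiameter σ N) (N + 1) :=
    fun N => Classical.choice (nonempty_flow hσpos hσhalf N) with hΦdef
  -- the witness `F(x,v) = 5 + (-1)·‖v‖²`
  set F : T3 × V3 → ℝ := fun y => 5 + (-1) * ‖y.2‖ ^ 2 with hFdef
  have hFc : Continuous F := by rw [hFdef]; fun_prop
  have hFg : ∃ C : ℝ, ∀ y, |F y| ≤ C * (1 + ‖y.2‖ ^ 2) := by
    refine ⟨5, fun y => ?_⟩
    rw [hFdef]
    have h0 : 0 ≤ ‖y.2‖ ^ 2 := sq_nonneg _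
    rw [abs_le]
    constructor <;> nlinarith
  have hFv : ∀ (x : T3) (j : Fin 3), ∫ v, F (x, v) * v j * localMaxwellian 1 1 (0 : V3) v = 0 := by
    intro x j
    simp only [hFdef]
    exact integral_radial_mul_coord_mul_localMaxwellian (fun s => 5 + (-1) * s) 1 j
  have hFE : ∀ x : T3, ∫ v, F (x, v) * ‖v‖ ^ 2 * localMaxwellian 1 1 (0 : V3) v = 0 := by
    intro x
    simp only [hFdef]
    rw [integral_affine_normSq_mul_normSq_mul_localMaxwellian 5 (-1)]
    norm_num
  obtain ⟨β₀, hβ₀, hβ⟩ := h 1 1 0 one_pos one_pos σ hσpos hσlt Φ F hFc hFg hFv hFE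
  set β : ℝ := min β₀ (1 / 4) with hβdef
  have hβpos : 0 < β := lt_min hβ₀ (by norm_num)
  have hβle : |β| ≤ β₀ := by rw [abs_of_pos hβpos]; exact min_le_left _ _
  have hc : 0 < 1 - 2 * (β * (-1)) := by linarith
  set ε : ℝ := (β * 5 - 3 / 2 * Real.log (1 - 2 * (β * (-1)))) / 2 with hεdef
  have hlog : Real.log (1 - 2 * (β * (-1))) < 2 * β := by
    have h := Real.log_lt_sub_one_of_pos hc (by linarith)
    linarith
  have hε : 0 < ε := by rw [hεdef]; linarith
  obtain ⟨τ, hτ, N₀, hN⟩ := hβ β hβle ε hε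
  have hw : 0 < τ * ((N₀ : ℝ) + 1) ^ (-(1 / 3 : ℝ)) := mul_pos hτ (Real.rpow_pos_of_pos (by positivity) _)
  have hval := windowMoment_affine_normSq_eq one_pos hσ2 N₀ (Φ N₀) 5 (-1) (β := β) (by linarith) hw
  exact not_le_of_moment_eq hc hε (by rw [hεdef]; ring) N₀ hval (hN N₀ le_rfl)

end Summit.AtomisticToContinuum.HydrodynamicLimit.Theorems.EquilibriumFastWindowLDNegative

end
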